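import Mathlib
import HarnessLib
import Summits.ABC.ABC.Theses.GvfSupportTransfer

/-!
# Crux `LinearLawTransfer` (stmt-ABC-11084) — exceptional-curve decomposition (strategist split)

Crux workfile `Cruxes/LinearLawTransfer/StrategySplit.lean` of the crux-strategist seat
`planner-cstrat-stmt-ABC-11084-r1-0` (2026-08-17), companion of `STRATEGY-CENSUS.md` and `SPLIT.md` in the same
directory. It holds the ASSEMBLY THEOREM of the typed decomposition of the crux `LinearLawTransfer` (LLT) of route
GvfSupportTransfer, in the shape `X₁ → X₂ → X₃ → LinearLawTransfer`. `Summits/…/Theorems` is prover-only, so this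
file lives in the crux directory; any prover may land it VERBATIM (renaming the namespace to `Summit.ABC.ABC.Theorems`)
as `Theorems/GvfSupportTransferLinearLawTransferSplit.lean --supports stmt-ABC-11084`, after which
`ledger route edit route-ABC-GvfSupportTransfer --split LinearLawTransfer --into children.json --glue-by
Summit.ABC.ABC.Theorems.linearLawTransfer_of_subs` makes LLT a derived node (until then the split carries a glue
support item with this statement, closed by `exact` of this theorem once landed).
The three hypotheses are, verbatim, the statements of the split children (`SPLIT.md`, `children.json`):

* `X₁ = GenericLawTransfer` (crux, open): LLT OFF AN EXCEPTIONAL CURVE — for every linear height law valid on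
  complex function fields and every `δ > 0` there is a nonzero `G ∈ ℤ[X,Y]` and `H₀` such that the law holds up to
  `δ·h(1:x:y)` at all rational points off `{G = 0}` (and off the law's own curves) of height `≥ H₀`
  (Vojta-shaped: main inequality outside a proper Zariski-closed set);
* `X₂ = LowGenusCurveLaw` (support, known — Weil height machine + Néron–Tate): the law holds asymptotically along
  the rational points of any irreducible plane curve `P = 0` (`P` prime in `ℚ[X,Y]`) whose function field
  `Frac(ℚ[X,Y]/(P))` satisfies `deg D + 1 − ℓ(D) ≤ 1` for all divisors over `ℚ` (genus ≤ 1);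
* `X₃ = PlaneMordell` (support, known — Faltings 1983): if that genus condition fails, `{P = 0}(ℚ)` is finite.

PROOF (the seam is not a one-liner): map the exceptional `G` to `ℚ[X,Y]` (injective, evaluation-compatible),
factor it into its finitely many prime factors (`UniqueFactorizationMonoid.factors`), show a rational zero of `G`
is a zero of some prime factor (evaluation is a ring hom, units evaluate to units), obtain a threshold `H_P` per
prime factor — from `X₂` in the genus-≤-1 case, and in the other case vacuously above the maximal height of the
finitely many rational points given by `X₃` — and take `H₀ := max(H_G, Σ_P max(H_P, 0))`.

No `def`s; unconditional; `sorry`-free; standard axioms (propext, Classical.choice, Quot.sound); no named facts.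
-/

set_option linter.dupNamespace false

namespace Summit.ABC.ABC.Cruxes.LinearLawTransfer.Strategist

open Summit.ABC.ABC.Theses.GvfSupportTransfer
open scoped BigOperators

/-- **Assembly of the exceptional-curve decomposition of `LinearLawTransfer`.**
`GenericLawTransfer → LowGenusCurveLaw → PlaneMordell → LinearLawTransfer`: given a law valid on complex
function fields and `δ > 0`, piece 1 yields a nonzero exceptional polynomial `G ∈ ℤ[X,Y]` off whose zero locus the
law holds beyond height `H_A`; `G` is factored over `ℚ` into finitely many prime factors `P` (UFD `ℚ[X,Y]`); a
rational zero of `G` is a zero of some `P`; for each `P` either its function field `Frac(ℚ[X,Y]/(P))` has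
`deg D + 1 − ℓ(D) ≤ 1` for all divisors (genus ≤ 1 over the exact constant field) and piece 2 gives a threshold
`H_P`, or not, and piece 3 (Mordell–Faltings for plane curves) makes `{P = 0}(ℚ)` finite, so `H_P := 1 + max height`
works vacuously; `H₀ := max(H_A, Σ_P max(H_P,0))`. [folklore] -/
theorem linearLawTransfer_of_subs :
    (∀ (m n : ℕ) (T : Fin m → Fin (n + 1) → MvPolynomial (Fin 2) ℤ) (c : Fin m → ℝ) (C : ℝ), (∀ (F : Type) [Field F] [Algebra ℂ F], Algebra.trdeg ℂ F = 1 → (⊤ : IntermediateField ℂ F).FG → ∀ g : ℕ, (∀ D : Literature.NumberTheory.DiophantineGeometry.AlgFunctionField.Divisor ℂ F, D.degree + 1 - (Literature.NumberTheory.DiophantineGeometry.AlgFunctionField.ell D : ℤ) ≤ g) → ∀ ξ η : F, (∀ j i, MvPolynomial.aeval ![ξ, η] (T j i) ≠ 0) → ∑ j, c j * ∑ᶠ v : Literature.NumberTheory.DiophantineGeometry.AlgFunctionField.PlaceOver ℂ F, ((v.degree : ℝ) * ⨆ i, (-(v.ord (MvPolynomial.aeval ![ξ, η] (T j i))) : ℝ))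 ≤ C * max 0 (2 * (g : ℝ) - 2)) → ∀ δ : ℝ, 0 < δ → ∃ G : MvPolynomial (Fin 2) ℤ, G ≠ 0 ∧ ∃ H₀ : ℝ, ∀ x y : ℚ, (∀ j i, MvPolynomial.aeval ![x, y] (T j i) ≠ 0) → MvPolynomial.aeval ![x, y] G ≠ 0 → H₀ ≤ Height.logHeight ![(1 : ℚ), x, y] → ∑ j, c j * Height.logHeight (fun i => MvPolynomial.aeval ![x, y] (T j i)) ≤ δ * Height.logHeight ![(1 : ℚ), x, y]) →
    (∀ (m n : ℕ) (T : Fin m → Fin (n + 1) → MvPolynomial (Fin 2) ℤ) (c : Fin m → ℝ) (C : ℝ), (∀ (F : Type) [Field F] [Algebra ℂ F], Algebra.trdeg ℂ F = 1 → (⊤ : IntermediateField ℂ F).FG → ∀ g : ℕ, (∀ D : Literature.NumberTheory.DiophantineGeometry.AlgFunctionField.Divisor ℂ F, D.degree + 1 - (Literature.NumberTheory.DiophantineGeometry.AlgFunctionField.ell D : ℤ) ≤ g) → ∀ ξ η : F, (∀ j i, MvPolynomial.aeval ![ξ, η] (T j i) ≠ 0) → ∑ j, c j * ∑ᶠ v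 : Literature.NumberTheory.DiophantineGeometry.AlgFunctionField.PlaceOver ℂ F, ((v.degree : ℝ) * ⨆ i, (-(v.ord (MvPolynomial.aeval ![ξ, η] (T j i))) : ℝ)) ≤ C * max 0 (2 * (g : ℝ) - 2)) → ∀ (P : MvPolynomial (Fin 2) ℚ) (hP : Prime P), (haveI : (Ideal.span {P}).IsPrime := (Ideal.span_singleton_prime hP.ne_zero).mpr hP; ∀ D : Literature.NumberTheory.DiophantineGeometry.AlgFunctionField.Divisor ℚ (FractionRing (MvPolynomial (Fin 2) ℚ ⧸ Ideal.span {P})), D.degree + 1 - (Literature.NumberTheory.DiophantineGeometry.AlgFunctionField.ell D : ℤ) ≤ 1) → ∀ δ : ℝ, 0 < δ → ∃ H₀ : ℝ, ∀ x y : ℚ, MvPolynomial.aeval ![x, y] P = 0 → (∀ j i, MvPolynomial.aeval ![x, y] (T j i) ≠ 0) → H₀ ≤ Height.logHeight ![(1 : ℚ), x, y] → ∑ j, c j * Height.logHeight (fun i => MvPolynomial.aeval ![x, y] (T j i)) ≤ δ * Height.logHeight ![(1 : ℚ), x, y]) →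
    (∀ (P : MvPolynomial (Fin 2) ℚ) (hP : Prime P), (haveI : (Ideal.span {P}).IsPrime := (Ideal.span_singleton_prime hP.ne_zero).mpr hP; ¬ ∀ D : Literature.NumberTheory.DiophantineGeometry.AlgFunctionField.Divisor ℚ (FractionRing (MvPolynomial (Fin 2) ℚ ⧸ Ideal.span {P})), D.degree + 1 - (Literature.NumberTheory.DiophantineGeometry.AlgFunctionField.ell D : ℤ) ≤ 1) → Set.Finite {p : ℚ × ℚ | MvPolynomial.aeval ![p.1, p.2] P = 0}) →
    LinearLawTransfer := by
  intro hA hB hM m n T c C hFF δ hδ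
  classical
  obtain ⟨G, hG0, HA, hAH⟩ := hA m n T c C hFF δ hδ
  -- the exceptional polynomial over `ℚ`
  set G' : MvPolynomial (Fin 2) ℚ := MvPolynomial.map (Int.castRingHom ℚ) G with hG'def
  have hG'0 : G' ≠ 0 := by
    intro h
    apply hG0
    apply MvPolynomial.map_injective (Int.castRingHom ℚ) (Int.castRingHom ℚ).injective_int
    rw [map_zero]
    exact h
  have haevalG' : ∀ x y : ℚ, MvPolynomial.aeval ![x, y] G' = MvPolynomial.aeval ![x, y] G := by
    intro x y
    rw [hG'def, show Int.castRingHom ℚ = algebraMap ℤ ℚ from rfl, MvPolynomial.aeval_map_algebraMap]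
  -- prime factors of `G'`
  set S : Finset (MvPolynomial (Fin 2) ℚ) := (UniqueFactorizationMonoid.factors G').toFinset with hSdef
  have hSprime : ∀ P ∈ S, Prime P := fun P hP =>
    UniqueFactorizationMonoid.prime_of_factor P (Multiset.mem_toFinset.mp hP)
  have hroot : ∀ x y : ℚ, MvPolynomial.aeval ![x, y] G = 0 →
      ∃ P ∈ S, MvPolynomial.aeval ![x, y] P = 0 := by
    intro x y hxy
    rw [← haevalG'] at hxy
    obtain ⟨u, hu⟩ := UniqueFactorizationMonoid.factors_prod hG'0
    have hu' : MvPolynomial.aeval ![x, y] (UniqueFactorizationMonoid.factors G').prod *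
        MvPolynomial.aeval ![x, y] (↑u : MvPolynomial (Fin 2) ℚ) = 0 := by
      rw [← map_mul, hu, hxy]
    have hunit : MvPolynomial.aeval ![x, y] (↑u : MvPolynomial (Fin 2) ℚ) ≠ 0 :=
      (Units.map (MvPolynomial.aeval ![x, y] : MvPolynomial (Fin 2) ℚ →ₐ[ℚ] ℚ).toMonoidHom u).ne_zero
    have hprod : MvPolynomial.aeval ![x, y] (UniqueFactorizationMonoid.factors G').prod = 0 :=
      (mul_eq_zero.mp hu').resolve_right hunit
    rw [map_multiset_prod, Multiset.prod_eq_zero_iff, Multiset.mem_map] at hprod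
    obtain ⟨P, hP, hP0⟩ := hprod
    exact ⟨P, Multiset.mem_toFinset.mpr hP, hP0⟩
  -- per-factor threshold
  have key : ∀ P : MvPolynomial (Fin 2) ℚ, Prime P → ∃ H : ℝ, ∀ x y : ℚ,
      MvPolynomial.aeval ![x, y] P = 0 → (∀ j i, MvPolynomial.aeval ![x, y] (T j i) ≠ 0) →
      H ≤ Height.logHeight ![(1 : ℚ), x, y] →
      ∑ j, c j * Height.logHeight (fun i => MvPolynomial.aeval ![x, y] (T j i)) ≤
        δ * Height.logHeight ![(1 : ℚ), x, y] := by
    intro P hP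
    by_cases hg : (haveI : (Ideal.span {P}).IsPrime := (Ideal.span_singleton_prime hP.ne_zero).mpr hP; ∀ D : Literature.NumberTheory.DiophantineGeometry.AlgFunctionField.Divisor ℚ (FractionRing (MvPolynomial (Fin 2) ℚ ⧸ Ideal.span {P})), D.degree + 1 - (Literature.NumberTheory.DiophantineGeometry.AlgFunctionField.ell D : ℤ) ≤ 1)
    · exact hB m n T c C hFF P hP hg δ hδ
    · have hfin := hM P hP hg
      obtain ⟨B, hBd⟩ :=
        (hfin.image (fun p : ℚ × ℚ => Height.logHeight ![(1 : ℚ), p.1, p.2])).bddAbove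
      refine ⟨B + 1, fun x y hPxy _ hH => ?_⟩
      exfalso
      have hle : Height.logHeight ![(1 : ℚ), x, y] ≤ B :=
        hBd (Set.mem_image_of_mem (fun p : ℚ × ℚ => Height.logHeight ![(1 : ℚ), p.1, p.2])
          (show ((x, y) : ℚ × ℚ) ∈ {p : ℚ × ℚ | MvPolynomial.aeval ![p.1, p.2] P = 0} from hPxy))
      linarith
  choose! Hf hHf using key
  refine ⟨max HA (∑ P ∈ S, max (Hf P) 0), fun x y hT hH => ?_⟩
  by_cases hGxy : MvPolynomial.aeval ![x, y] G = 0
  · obtain ⟨P, hPS, hP0⟩ := hroot x y hGxy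
    have h1 : Hf P ≤ ∑ Q ∈ S, max (Hf Q) 0 :=
      (le_max_left _ _).trans
        (Finset.single_le_sum (f := fun Q => max (Hf Q) 0) (fun Q _ => le_max_right _ _) hPS)
    exact hHf P (hSprime P hPS) x y hP0 hT (h1.trans ((le_max_right _ _).trans hH))
  · exact hAH x y hT hGxy ((le_max_left _ _).trans hH)

end Summit.ABC.ABC.Cruxes.LinearLawTransfer.Strategist
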